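import Summits.QuantumAdvantage.QuantumAdvantage.Theses.SosSandwich
import Summits.QuantumAdvantage.QuantumAdvantage.Theorems.SosSandwichQueryDilation
import Literature.Computability.QuantumComplexity.AaronsonAmbainisL1Form
import HarnessLib

/-!
# `PB-AA ⟸ AA_Q + AFFINE relaxed dilation` (multiplicative factor, additive shift, query overhead)

Support theorem (reduction) for route `SosSandwich`, crux `PseudoBoundedAA` (stmt-QuantumAdvantage-15237);
sibling of `SosSandwichQueryDilationReduction` (which has the strict and the relaxed multiplicative forms); imports only
the route file itself and route-independent modules.

The literature's "converses to the polynomial method" (Aaronson–Ambainis–Iraids–Kokainis–Smotrovs CCC'16;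
Briët–Escudero Gutiérrez–Gribling, arXiv:2212.08559, via completely bounded norms / Grothendieck inequalities)
realise a bounded polynomial `p` as `L · E[±1 output] + κ` of a query algorithm — a MULTIPLICATIVE factor AND an
ADDITIVE shift (degree 2 / one query: universal factor `K_G`; degree 4 / two queries: NO universal factor).
Variance and influences are blind to the shift, so the reduction `PB-AA ⟸ AA_Q ∧ dilation` extends verbatim to
the affine notion with polynomial query overhead:

* `pseudoBoundedAA_of_aaQuery_of_affineDilation` — if every `p ∈ K_T` is `L·acceptProb_A + κ` for some
  algorithm `A` with `1 ≤ #queries ≤ D·T^d` and `L² ≤ B·T^a`, then `AA_Q` (the Aaronson–Ambainis conjecture for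
  genuine quantum acceptance probabilities) implies the crux `PseudoBoundedAA`, `(c', C') = (c(a+d+1)+1, C/(B·D)^c)`.

Honest label: reduction only (audit: conditional); the affine dilation bound is the open "quantitative
Kaniewski–Lee–de Wolf with query overhead" estimate, true with `L = 1` on the address family (exact classical
computation of `G_k` in `3^k` queries).

Sources: KaniewskiLeeDewolf2015 (arXiv:1411.7280) Thm. 12; BrietEscuderoGutierrezGribling2024 (arXiv:2212.08559);
AaronsonAmbainis2014 Conj. 6.
-/

noncomputable section

set_option linter.dupNamespace false

namespace Summit.QuantumAdvantage.QuantumAdvantage.Theorems.SosSandwich.QueryDilation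

open Finset MvPolynomial Literature.Computability.Cryptography Literature.Computability.QuantumComplexity
open Literature.Computability.Complexity.LowDegree
open Summit.QuantumAdvantage.QuantumAdvantage.Theses.SosSandwich (PseudoBoundedAA)

variable {N : ℕ}

/-! ### Shift invariance -/

/-- A polynomial carrying the cube values of an acceptance probability has variance `≤ 1` (crude: values in
`[0,1]`). [cite: BealsEtAl2001, §2] -/
theorem boolVariance_le_one_of_acceptProb (A : QQueryAlg N) (q : MvPolynomial (Fin N) ℝ)
    (hqa : ∀ x, evalBool q x = A.acceptProb x) : boolVariance q ≤ 1 := by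
  have h0 : ∀ x, 0 ≤ evalBool q x := fun x => by rw [hqa x]; exact A.acceptProb_nonneg x
  have h1 : ∀ x, evalBool q x ≤ 1 := fun x => by rw [hqa x]; exact A.acceptProb_le_one' x
  have hμ0 : 0 ≤ boolAvg (evalBool q) := boolAvg_nonneg h0
  have hμ1 : boolAvg (evalBool q) ≤ 1 := AaronsonAmbainisL1.boolAvg_le_one h1
  refine AaronsonAmbainisL1.boolAvg_le_one fun x => ?_
  have ha : -1 ≤ evalBool q x - boolAvg (evalBool q) := by linarith [h0 x]
  have hb : evalBool q x - boolAvg (evalBool q) ≤ 1 := by linarith [h1 x]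
  nlinarith

/-- Adding a constant does not change the variance. [folklore] -/
theorem boolVariance_sub_C (p : MvPolynomial (Fin N) ℝ) (κ : ℝ) :
    boolVariance (p - MvPolynomial.C κ) = boolVariance p := by
  unfold boolVariance
  have he : evalBool (p - MvPolynomial.C κ) = fun x => evalBool p x - κ :=
    funext fun x => by rw [AddrWitness.evalBool_sub', AddrWitness.evalBool_C']
  rw [he, show (fun x => evalBool p x - κ) = fun x => evalBool p x - (fun _ => κ) x from rfl, avg_sub,
    boolAvg_const]
  congr 1
  funext x
  ring

/-- Adding a constant does not change the influences. [folklore] -/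
theorem influence_sub_C (i : Fin N) (p : MvPolynomial (Fin N) ℝ) (κ : ℝ) :
    influence i (p - MvPolynomial.C κ) = influence i p := by
  unfold influence
  congr 1
  funext x
  rw [AddrWitness.evalBool_sub', AddrWitness.evalBool_C', AddrWitness.evalBool_sub', AddrWitness.evalBool_C']
  ring

/-- **`PseudoBoundedAA ⟸ AA_Q ∧ affine relaxed dilation.**  Suppose (i) `AA_Q` as in
`pseudoBoundedAA_of_aaQuery_of_polyDilation`, and (ii) AFFINE relaxed dilation: every `p` pseudo-bounded of order
`T ≥ 1` is `L · acceptProb_A + κ` on the cube for SOME quantum algorithm `A` with `1 ≤ #queries ≤ D·T^d`, some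
real `L` with `L² ≤ B·T^a` and some real shift `κ` ("computed exactly in expectation up to a multiplicative factor
and an additive shift, with polynomial query overhead").  Then the crux `PseudoBoundedAA` holds with
`(c', C') = (c(a+d+1)+1, C/(B·D)^c)`. (Reduction only; (ii) is not proved here — for degree `4`/`2` queries
WITHOUT overhead no universal factor exists, arXiv:2212.08559.) [cite: KaniewskiLeeDewolf2015, Thm. 12]
[cite: AaronsonAmbainis2014, Conj. 6] -/
theorem pseudoBoundedAA_of_aaQuery_of_affineDilation
    (hQ : ∃ (c : ℕ) (C : ℝ), 0 < C ∧ ∀ (N : ℕ) (Q : QQueryAlg N) (q : MvPolynomial (Fin N) ℝ) (ε : ℝ),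
      1 ≤ Q.queries → (∀ x, evalBool q x = Q.acceptProb x) → 0 < ε → ε ≤ boolVariance q →
        ∃ i : Fin N, C * (ε / Q.queries) ^ c ≤ influence i q)
    (hD : ∃ (a d : ℕ) (B D : ℝ), 0 < B ∧ 0 < D ∧ ∀ (N T : ℕ) (p : MvPolynomial (Fin N) ℝ), 1 ≤ T →
      PseudoBounded T p →
      ∃ (A : QQueryAlg N) (L κ : ℝ), 1 ≤ A.queries ∧ (A.queries : ℝ) ≤ D * (T : ℝ) ^ d ∧
        L ^ 2 ≤ B * (T : ℝ) ^ a ∧ ∀ x, evalBool p x = L * A.acceptProb x + κ) :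
    PseudoBoundedAA := by
  obtain ⟨c, C, hC, hQb⟩ := hQ
  obtain ⟨a, d, B, D, hB, hDpos, hDb⟩ := hD
  refine ⟨c * (a + d + 1) + 1, C / (B * D) ^ c, by positivity, fun N T p ε hT hp hε hv => ?_⟩
  have hp' : PseudoBounded T p := hp
  obtain ⟨A, L, κ, hT', hAq, hL, hpL⟩ := hDb N T p hT hp'
  -- pass to the shifted polynomial `p₀ = p − κ = L · acceptProb_A`
  set p₀ : MvPolynomial (Fin N) ℝ := p - MvPolynomial.C κ with hp₀
  have hv' : ε ≤ boolVariance p₀ := by rw [hp₀, boolVariance_sub_C]; exact hv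
  have hV4 : boolVariance p₀ ≤ 1 / 4 := by rw [hp₀, boolVariance_sub_C]; exact boolVariance_le_quarter hp'
  have hp₀L : ∀ x, evalBool p₀ x = L * A.acceptProb x := fun x => by
    rw [hp₀, AddrWitness.evalBool_sub', AddrWitness.evalBool_C', hpL x]; ring
  have hTpos : (0 : ℝ) < T := by exact_mod_cast hT
  have hT1 : (1 : ℝ) ≤ T := by exact_mod_cast hT
  have hT'pos : (0 : ℝ) < A.queries := by exact_mod_cast hT'
  -- `L ≠ 0`: otherwise `p₀` vanishes on the cube and has variance `0 < ε`
  have hL0 : L ≠ 0 := by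
    rintro rfl
    have hz : evalBool p₀ = fun _ => 0 := funext fun x => by rw [hp₀L x, zero_mul]
    have hv0 : boolVariance p₀ = 0 := by
      unfold boolVariance
      rw [hz, boolAvg_const]
      simp only [sub_self, zero_pow two_ne_zero, boolAvg_const]
    linarith
  have hL2 : 0 < L ^ 2 := by positivity
  -- the acceptance polynomial `q = L⁻¹ p₀`
  set q : MvPolynomial (Fin N) ℝ := MvPolynomial.C L⁻¹ * p₀ with hq
  have hqa : ∀ x, evalBool q x = A.acceptProb x := fun x => by
    rw [hq, AddrWitness.evalBool_C_mul', hp₀L x, ← mul_assoc, inv_mul_cancel₀ hL0, one_mul]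
  have hVq : boolVariance q = (L ^ 2)⁻¹ * boolVariance p₀ := by
    rw [hq, boolVariance_C_mul, inv_pow]
  have hIq : ∀ i, influence i q = (L ^ 2)⁻¹ * influence i p := fun i => by
    rw [hq, influence_C_mul, inv_pow, hp₀, influence_sub_C]
  -- `Var[q] ≤ 1`, hence `ε ≤ L²`
  have hVq1 : boolVariance q ≤ 1 := boolVariance_le_one_of_acceptProb A q hqa
  have hεL : ε ≤ L ^ 2 := by
    have h1 : ε ≤ L ^ 2 * boolVariance q := by
      rw [hVq, ← mul_assoc, mul_inv_cancel₀ hL2.ne', one_mul]; exact hv'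
    nlinarith [boolVariance_nonneg q]
  -- apply `AA_Q` to `q` with `ε / L²`
  have hε' : 0 < ε / L ^ 2 := div_pos hε hL2
  have hε'v : ε / L ^ 2 ≤ boolVariance q := by
    rw [hVq, div_eq_inv_mul]
    exact mul_le_mul_of_nonneg_left hv' (inv_nonneg.mpr hL2.le)
  obtain ⟨i, hi⟩ := hQb N A q (ε / L ^ 2) hT' hqa hε' hε'v
  refine ⟨i, ?_⟩
  show C / (B * D) ^ c * (ε / (T : ℝ)) ^ (c * (a + d + 1) + 1) ≤ influence i p
  rw [hIq] at hi
  have hi' : C * L ^ 2 * (ε / L ^ 2 / (A.queries : ℝ)) ^ c ≤ influence i p := by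
    rw [← div_eq_inv_mul, le_div_iff₀ hL2] at hi
    calc C * L ^ 2 * (ε / L ^ 2 / (A.queries : ℝ)) ^ c
        = C * (ε / L ^ 2 / (A.queries : ℝ)) ^ c * L ^ 2 := by ring
      _ ≤ influence i p := hi
  have hε1 : ε ≤ 1 := hv'.trans (hV4.trans (by norm_num))
  have hLT : L ^ 2 * (A.queries : ℝ) ≤ B * D * (T : ℝ) ^ (a + d + 1) := by
    calc L ^ 2 * (A.queries : ℝ) ≤ B * (T : ℝ) ^ a * (D * (T : ℝ) ^ d) :=
          mul_le_mul hL hAq hT'pos.le (by positivity)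
      _ = B * D * (T : ℝ) ^ (a + d) := by rw [pow_add]; ring
      _ ≤ B * D * (T : ℝ) ^ (a + d + 1) :=
          mul_le_mul_of_nonneg_left (pow_le_pow_right₀ hT1 (Nat.le_succ _)) (by positivity)
  have step1 : (ε / (B * D * (T : ℝ) ^ (a + d + 1))) ^ c ≤ (ε / L ^ 2 / (A.queries : ℝ)) ^ c := by
    apply pow_le_pow_left₀ (by positivity)
    rw [div_div]
    exact div_le_div_of_nonneg_left hε.le (by positivity) hLT
  have step2 : C / (B * D) ^ c * (ε / (T : ℝ)) ^ (c * (a + d + 1) + 1) ≤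
      C * ε * (ε / (B * D * (T : ℝ) ^ (a + d + 1))) ^ c := by
    rw [pow_succ, pow_mul']
    have e1 : (ε / (T : ℝ)) ^ (a + d + 1) ≤ ε / (T : ℝ) ^ (a + d + 1) := by
      rw [div_pow]
      exact div_le_div_of_nonneg_right (pow_le_of_le_one hε.le hε1 (Nat.succ_ne_zero _)) (by positivity)
    have e2 : ε / (T : ℝ) ≤ ε := div_le_self hε.le hT1
    have e3 : (ε / (T : ℝ) ^ (a + d + 1)) ^ c / (B * D) ^ c = (ε / (B * D * (T : ℝ) ^ (a + d + 1))) ^ c := by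
      rw [← div_pow, div_div, mul_comm]
    calc C / (B * D) ^ c * (((ε / (T : ℝ)) ^ (a + d + 1)) ^ c * (ε / (T : ℝ)))
        ≤ C / (B * D) ^ c * ((ε / (T : ℝ) ^ (a + d + 1)) ^ c * ε) := by gcongr
      _ = C * ε * ((ε / (T : ℝ) ^ (a + d + 1)) ^ c / (B * D) ^ c) := by ring
      _ = C * ε * (ε / (B * D * (T : ℝ) ^ (a + d + 1))) ^ c := by rw [e3]
  calc C / (B * D) ^ c * (ε / (T : ℝ)) ^ (c * (a + d + 1) + 1)
      ≤ C * ε * (ε / (B * D * (T : ℝ) ^ (a + d + 1))) ^ c := step2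
    _ ≤ C * L ^ 2 * (ε / (B * D * (T : ℝ) ^ (a + d + 1))) ^ c := by gcongr
    _ ≤ C * L ^ 2 * (ε / L ^ 2 / (A.queries : ℝ)) ^ c := by gcongr
    _ ≤ influence i p := hi'

end Summit.QuantumAdvantage.QuantumAdvantage.Theorems.SosSandwich.QueryDilation

end
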